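import Summits.CriticalPhenomena.PercolationContinuityZ3.Theorems.Transplant.SkelNegBParamsSlots
import Summits.CriticalPhenomena.PercolationContinuityZ3.Theorems.Transplant.SkelNegBParamsSched
import HarnessLib

/-!
# N1 params, chain of record `NegB`, part ReachFC: THE (C) CORRIDOR's LEDGER-DETERMINED NUMBERS under S1 (p5-g9 2026-08-21T17:53:02Z (C-A8) read list) — the frame change of
# the small arrival box `cen ± b0` into the v-rounds' start box (`FrameChangeFine.runX_mem_Icc_of_fine` at `K := b0`): **`NegB.aW/Bx/bL κ Φ t p D g f`** with
# **`ha_R/hBx_R/hb_R`** at the frame record `prF`'s fields; the v-round siting floor **`layer_R : (RA'+2)·(n_L+|h_L|) ≤ n_L·ℓ_L + 1`** at `g := KS.gR`; `b0_le_two`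
# (`b0 ≤ 2r`); `prF` positivity (`prF_pos`: `0 < A`, `1 ≤ n`, `0 < modulus`, `0 < D`); the values `W_A/L0_A/N_A/W_B/L0_B/N_B/q/N_C` follow in part Reach on p5-g9's closed forms

builds on p205010 (kernel theorem, internal audit signed; external expert review pending) — nothing in this file uses p205010; NOTHING is claimed about
the node `SamePDropOfSkeletonNeg₁` (OPEN).
Status sentence (coordinator 2026-08-20T04:30Z): "θ(p_c) = 0 on ℤ^d, all d ≥ 2 — kernel-verified (Lean 4/Mathlib, standard axioms); internal adversarial
audit SIGNED 2026-08-20 04:29Z; external expert review pending."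
Lane `prim-bschramm-*`, seat `prim-bschramm-stmt` (gen 14); helper file (`--supports stmt-CriticalPhenomena-4575 --as helper`); ledger HOME/prim-bschramm-stmt/NEG-PARAMS.md v0.12.
* §1 `ceil_mul_le` (`x ≤ d·(x/d + 1)` for `0 < d`), `prF_pos`, `b0_le_two`; §2 **`aW`, `Bx`, `bL`** + **`ha_R`, `hBx_R`, `hb_R`** (the three hypotheses of `runX_mem_Icc_of_fine` /
  `reachOblAtHN_negCorridor1` with `K₀ := b0 0`, `K₁ := b0 1`), `aW_nonneg/bL_pos`; §3 **`layer_R`** (and `eleven_RA'_le_ℓL`).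
[cite: KozmaNitzan2024, §4 Lemma 12 (pp. 23–25)] [cite: MartineauTassion2017, §4.3 Lemma 4.2]
-/

noncomputable section

open scoped Classical

namespace Summit.CriticalPhenomena.PercolationContinuityZ3.Theorems.Transplant

namespace PlanarSkeletonNeg

namespace NegB

open Literature.Probability.Percolation Literature.Probability.LatticeModels SimpleGraph
open SkelConc (Consts)
open Skelφ.StepI (DataN)
open TwoAxis.Para (modulus)
open Skelφ (shearUnit shearUnit_pos)
open Neg

/-! ## §1 Arithmetic and positivity -/

/-- `x ≤ d·(x/d + 1)` for `0 < d` (integer ceiling through floor). [folklore] -/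
theorem ceil_mul_le {x d : ℤ} (hd : 0 < d) : x ≤ d * (x / d + 1) := by
  have h1 := Int.lt_mul_ediv_self_add (x := x) hd
  linarith [mul_add d (x / d) 1]

section Values

variable (κ : Consts) {V : Type} [DecidableEq V] [Countable V] {G : SimpleGraph V} [G.LocallyFinite] (Φ : PlanarSkeletonNeg G) (t : V)
  (p : unitInterval) (D : DataN V) (g f : ℕ)

/-- **Positivity of the frame record** under the numeric long clause: `0 < A`, `1 ≤ n`, `0 < modulus n h vα vβ`, `0 < c₀`, `0 < c₁`, `0 < D`. [folklore] -/
theorem prF_pos (hN : EqNumL κ Φ t p D g f) :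
    0 < (prF κ Φ t p D g f).A ∧ 1 ≤ (prF κ Φ t p D g f).n ∧ 0 < modulus (prF κ Φ t p D g f).n (prF κ Φ t p D g f).h (prF κ Φ t p D g f).vα (prF κ Φ t p D g f).vβ ∧
      0 < (prF κ Φ t p D g f).c₀ ∧ 0 < (prF κ Φ t p D g f).c₁ ∧ 0 < (prF κ Φ t p D g f).D := by
  obtain ⟨hn1, hℓ1⟩ := one_le_of_eqNumL κ Φ t p D g f hN
  obtain ⟨hA, hn, hh, hvα, hvβ, -, -, -⟩ := prF_fields κ Φ t p D g f
  have hm : 0 < modulus (prF κ Φ t p D g f).n (prF κ Φ t p D g f).h (prF κ Φ t p D g f).vα (prF κ Φ t p D g f).vβ := by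
    rw [hn, hh, hvα, hvβ]; exact Skelφ.NegPrm.modulus_vβOf_pos hn1 hℓ1 _ _
  refine ⟨by rw [hA]; norm_num, by rw [hn]; exact_mod_cast hn1, hm, (prF_c_pos κ Φ t p D g f).1, (prF_c_pos κ Φ t p D g f).2, ?_⟩
  rw [prF_D]; unfold TwoAxis.Para.detD; rw [hA]; positivity

/-- `b0 i ≤ 2·r i` (p5-g9's `hbr`). [folklore] -/
theorem b0_le_two (i : Fin 2) : b0 κ Φ t p D g f i ≤ 2 * (fcells κ Φ t p D g f).r i := by
  rw [b0_eq_div]; omega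

/-! ## §2 The frame change of the small box into the v-rounds' start box -/

/-- **The start box's α-half-width** `aW := ⌈D·(c₁·n·(b0₀+1) + c₀·|vα|·(b0₁+1)) / (c₀·c₁·A·modulus)⌉` (as floor + 1). [this work] -/
def aW : ℤ :=
  (prF κ Φ t p D g f).D * ((prF κ Φ t p D g f).c₁ * (prF κ Φ t p D g f).n * ((b0 κ Φ t p D g f 0 : ℤ) + 1) +
      (prF κ Φ t p D g f).c₀ * |(prF κ Φ t p D g f).vα| * ((b0 κ Φ t p D g f 1 : ℤ) + 1)) /
    ((prF κ Φ t p D g f).c₀ * (prF κ Φ t p D g f).c₁ * (prF κ Φ t p D g f).A *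
      modulus (prF κ Φ t p D g f).n (prF κ Φ t p D g f).h (prF κ Φ t p D g f).vα (prF κ Φ t p D g f).vβ) + 1

/-- **The β′-extent of the box** `Bx := ⌈D·(b0₁+1) / (c₁·A)⌉`. [this work] -/
def Bx : ℤ := (prF κ Φ t p D g f).D * ((b0 κ Φ t p D g f 1 : ℤ) + 1) / ((prF κ Φ t p D g f).c₁ * (prF κ Φ t p D g f).A) + 1

/-- **The start box's half-width in levels** `bL := Bx / U + 1` (`U = n + |h|`). [this work] -/
def bL : ℤ := Bx κ Φ t p D g f / (shearUnit (nL κ Φ t p D g f) (hL κ Φ t p D g f) : ℤ) + 1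

/-- **`ha`** of `runX_mem_Icc_of_fine` / `reachOblAtHN_negCorridor1` at `K := b0`, `a := aW`. [folklore] -/
theorem ha_R (hN : EqNumL κ Φ t p D g f) :
    (prF κ Φ t p D g f).D * ((prF κ Φ t p D g f).c₁ * ((prF κ Φ t p D g f).n : ℤ) * ((b0 κ Φ t p D g f 0 : ℤ) + 1) +
        (prF κ Φ t p D g f).c₀ * |(prF κ Φ t p D g f).vα| * ((b0 κ Φ t p D g f 1 : ℤ) + 1)) ≤
      (prF κ Φ t p D g f).c₀ * (prF κ Φ t p D g f).c₁ * (prF κ Φ t p D g f).A *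
        modulus (prF κ Φ t p D g f).n (prF κ Φ t p D g f).h (prF κ Φ t p D g f).vα (prF κ Φ t p D g f).vβ * aW κ Φ t p D g f := by
  obtain ⟨hA, -, hm, hc₀, hc₁, -⟩ := prF_pos κ Φ t p D g f hN
  unfold aW
  exact ceil_mul_le (by positivity)

/-- **`hBx`**: `D·(b0₁+1) ≤ c₁·A·Bx`. [folklore] -/
theorem hBx_R (hN : EqNumL κ Φ t p D g f) : (prF κ Φ t p D g f).D * ((b0 κ Φ t p D g f 1 : ℤ) + 1) ≤ (prF κ Φ t p D g f).c₁ * (prF κ Φ t p D g f).A * Bx κ Φ t p D g f := by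
  obtain ⟨hA, -, -, -, hc₁, -⟩ := prF_pos κ Φ t p D g f hN
  unfold Bx
  exact ceil_mul_le (by positivity)

/-- **`hb`**: `Bx / U + 1 ≤ bL` (by `rfl`; `U := shearUnit n_L h_L` — the corridor's `n, h` are `n_L, h_L` = `prF.n, prF.h` by `prF_fields`). [folklore] -/
theorem hb_R : Bx κ Φ t p D g f / (shearUnit (nL κ Φ t p D g f) (hL κ Φ t p D g f) : ℤ) + 1 ≤ bL κ Φ t p D g f := le_rfl

/-- `0 ≤ aW`, `0 ≤ Bx`, `1 ≤ bL` (under the numeric long clause). [folklore] -/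
theorem aW_nonneg (hN : EqNumL κ Φ t p D g f) : 0 ≤ aW κ Φ t p D g f ∧ 0 ≤ Bx κ Φ t p D g f ∧ 1 ≤ bL κ Φ t p D g f := by
  obtain ⟨hA, hn, hm, hc₀, hc₁, hD⟩ := prF_pos κ Φ t p D g f hN
  have h0 : 0 ≤ aW κ Φ t p D g f := by
    unfold aW
    have : 0 ≤ (prF κ Φ t p D g f).D * ((prF κ Φ t p D g f).c₁ * (prF κ Φ t p D g f).n * ((b0 κ Φ t p D g f 0 : ℤ) + 1) +
        (prF κ Φ t p D g f).c₀ * |(prF κ Φ t p D g f).vα| * ((b0 κ Φ t p D g f 1 : ℤ) + 1)) /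
        ((prF κ Φ t p D g f).c₀ * (prF κ Φ t p D g f).c₁ * (prF κ Φ t p D g f).A *
          modulus (prF κ Φ t p D g f).n (prF κ Φ t p D g f).h (prF κ Φ t p D g f).vα (prF κ Φ t p D g f).vβ) :=
      Int.ediv_nonneg (by positivity) (by positivity)
    linarith
  have h1 : 0 ≤ Bx κ Φ t p D g f := by
    unfold Bx
    have : 0 ≤ (prF κ Φ t p D g f).D * ((b0 κ Φ t p D g f 1 : ℤ) + 1) / ((prF κ Φ t p D g f).c₁ * (prF κ Φ t p D g f).A) :=
      Int.ediv_nonneg (by positivity) (by positivity)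
    linarith
  refine ⟨h0, h1, ?_⟩
  unfold bL
  have hU : (0 : ℤ) < shearUnit (nL κ Φ t p D g f) (hL κ Φ t p D g f) := by
    exact shearUnit_pos (one_le_of_eqNumL κ Φ t p D g f hN).1 (hL κ Φ t p D g f)
  have : 0 ≤ Bx κ Φ t p D g f / (shearUnit (nL κ Φ t p D g f) (hL κ Φ t p D g f) : ℤ) := Int.ediv_nonneg h1 hU.le
  linarith

end Values

/-! ## §3 The v-round siting floor at the box value -/

section Layer

variable (κ : Consts) {V : Type} [DecidableEq V] [Countable V] {G : SimpleGraph V} [G.LocallyFinite] (Φ : PlanarSkeletonNeg G) (t : V)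
  (p : unitInterval) (D : DataN V) (mk gx f : ℕ)

/-- `11·(RA' + 2) ≤ ℓ_L` at `g := gR` (from `4K(RA'+2) ≤ M_L < ℓ_L`, `K ≥ 40`). [folklore] -/
theorem eleven_RA'_le_ℓL (hN : EqNumL κ Φ t p D (KS.gR mk gx κ Φ t p D) f) :
    11 * ((KS.RA' κ Φ t p D mk : ℤ) + 2) ≤ (ℓL κ Φ t p D (KS.gR mk gx κ Φ t p D) f : ℤ) := by
  have h1 := KS.ML_floorR_int κ Φ t p D mk gx
  have h2 := hN.ℓ_le
  have hK : (40 : ℤ) ≤ Neg.K κ := by exact_mod_cast (Neg.forty_le_K κ).1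
  nlinarith

/-- **THE v-ROUND SITING FLOOR** (p5-g9's `(RA′+2)·U_L ≤ n_L ℓ_L + 1` for `vLocPrmD_ok`'s `he`): at `g := gR`, any `gx f`. [folklore] -/
theorem layer_R (hN : EqNumL κ Φ t p D (KS.gR mk gx κ Φ t p D) f)
    (hκ : (hL κ Φ t p D (KS.gR mk gx κ Φ t p D) f).natAbs ≤ 10 * nL κ Φ t p D (KS.gR mk gx κ Φ t p D) f) :
    ((KS.RA' κ Φ t p D mk : ℤ) + 2) * ((nL κ Φ t p D (KS.gR mk gx κ Φ t p D) f + (hL κ Φ t p D (KS.gR mk gx κ Φ t p D) f).natAbs : ℕ) : ℤ) ≤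
      (nL κ Φ t p D (KS.gR mk gx κ Φ t p D) f : ℤ) * ℓL κ Φ t p D (KS.gR mk gx κ Φ t p D) f + 1 := by
  have h1 := eleven_RA'_le_ℓL κ Φ t p D mk gx f hN
  have hκ' : ((hL κ Φ t p D (KS.gR mk gx κ Φ t p D) f).natAbs : ℤ) ≤ 10 * (nL κ Φ t p D (KS.gR mk gx κ Φ t p D) f : ℤ) := by exact_mod_cast hκ
  have hn : (0 : ℤ) ≤ nL κ Φ t p D (KS.gR mk gx κ Φ t p D) f := by positivity
  have hR : (0 : ℤ) ≤ (KS.RA' κ Φ t p D mk : ℤ) + 2 := by positivity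
  push_cast
  nlinarith

end Layer

end NegB

end PlanarSkeletonNeg

end Summit.CriticalPhenomena.PercolationContinuityZ3.Theorems.Transplant

end
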